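import Mathlib
import HarnessLib

/-!
# Crux `GrenetZeon.PolySizeQPAlgebra` (stmt-ValiantsHypothesis-8064), line `vbp-slice-dealg` —
# `AL(3)` for the deep dimension-five type `(1,2,1,1)` = `ℂ[x,y]/(xy, y² - x³)`

The rung `(n, ≤ 5)` of the `c = 1` box is reduced (`…LocalReductionDeep`, `…BlockRankGeneral`,
census `Cruxes/PolySizeQPAlgebra/CensusLeafhand8AlWindow.md`) to input (A₆) plus two counts at a block
normal form `diag(1_κ, S)`, `S ∈ Mat₃(𝔪)`, `det S = 0`, over the ONLY deep local Frobenius type of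
dimension `5`, Hilbert function `(1,2,1,1)`, i.e. `R = ℂ[x,y]/(xy, y² - x³)` (basis `1, x, y, x², x³`):
`AL(3)`: `ℓ Col(adj S) + ℓ Row(adj S) ≤ 2·dim R = 10` and `G(3)`.  This file proves `AL(3)` for this
type, in presented form (generators `x, y` with `xy = 0`, `y² = x³`, `x⁴ = 0`, `x³ ≠ 0`, and
`R = ℂ + Rx + Ry`):

* `finrank_range_adjugate_mulVecLin_le_five` — **`dim_ℂ Col(adj S) ≤ 5`** for `S ∈ Mat₃((x,y))` with
  `det S = 0`.  Proof: the `2 × 2` minors lie in `x²R = ℂx² ⊕ ℂx³`, so `Col(adj S) ⊆ (x²R)³`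
  (dimension `6`); if equality held, `adj S · W = x²·1` for some `W`, whence
  `x² S = S·adj S·W = det S · W = 0`, so every entry of `S` lies in `Ann(x²) ∩ (x,y) = x²R + yR`, so
  every `2 × 2` minor lies in `x³R` and `x² ∈ x³R`, forcing `x² = 0` — contradiction.
* `adjugateLength_three_le` — **`AL(3)`**: `dim Col(adj S) + dim Row(adj S) ≤ 10` (transpose), and the
  form `≤ 2 · finrank ℂ R` consumed by `rank_hess0_transl_le_of_blockNormalForm_general_of_AL`
  (`…BlockRankGeneral`) when `5 ≤ dim R`; `…_of_ker` — the same with the entries of `S` in `ker φ`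
  for a character `φ` with `ker φ = (x, y)`.

HONEST FRAMING: a length count for one local type; what remains for the rung `(n, ≤ 5)` is `G(3)` for
this type, the classification "deep of dimension 5 ⟹ this presentation", and input (A₆).  No stub of the
line is closed; VP ≠ VNP is not moved.

References: T. Mignon, N. Ressayre, IMRN 2004:79, §2 [MignonRessayre2004].
-/

noncomputable section

open Matrix

-- single-conjunct layout `Summits/ValiantsHypothesis/ValiantsHypothesis`: duplicated namespace by design
set_option linter.dupNamespace false

namespace Summit.ValiantsHypothesis.ValiantsHypothesis.Theorems.GrenetZeonPolySizeQPAlgebra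

section OneTwoOneOne

variable {R : Type*} [CommRing R]

/-- Every entry of the adjugate of a `3 × 3` matrix is a difference of two products of two entries
(`Matrix.adjugate_fin_three`): a predicate holding for all such differences holds for all entries.
[folklore] -/
theorem adjugate_fin_three_induction (S : Matrix (Fin 3) (Fin 3) R) (P : R → Prop)
    (hP : ∀ i j k l i' j' k' l', P (S i j * S k l - S i' j' * S k' l')) (i j : Fin 3) :
    P (S.adjugate i j) := by
  have hP' : ∀ i j k l i' j' k' l', P (-(S i j * S k l) + S i' j' * S k' l') :=
    fun i j k l i' j' k' l' => by rw [neg_add_eq_sub]; exact hP _ _ _ _ _ _ _ _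
  rw [Matrix.adjugate_fin_three]
  fin_cases i <;> fin_cases j
  · exact hP _ _ _ _ _ _ _ _
  · exact hP' _ _ _ _ _ _ _ _
  · exact hP _ _ _ _ _ _ _ _
  · exact hP' _ _ _ _ _ _ _ _
  · exact hP _ _ _ _ _ _ _ _
  · exact hP' _ _ _ _ _ _ _ _
  · exact hP _ _ _ _ _ _ _ _
  · exact hP' _ _ _ _ _ _ _ _
  · exact hP _ _ _ _ _ _ _ _

/-- In `ℂ[x,y]/(xy, y² - x³)`-like rings: a product of two elements of the ideal `(x, y)` lies in
`x²R`. [folklore] -/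
theorem mul_mem_sq_of_rel {x y : R} (hxy : x * y = 0) (hyy : y * y = x ^ 3) {p q : R}
    (hp : ∃ a b, p = a * x + b * y) (hq : ∃ a b, q = a * x + b * y) : ∃ r, p * q = r * x ^ 2 := by
  obtain ⟨a, b, rfl⟩ := hp
  obtain ⟨c, d, rfl⟩ := hq
  exact ⟨a * c + b * d * x, by linear_combination (a * d + b * c) * hxy + b * d * hyy⟩

/-- In `ℂ[x,y]/(xy, y² - x³)`-like rings: a product of two elements of `x²R + yR` lies in `x³R`.
[folklore] -/
theorem mul_mem_cube_of_rel {x y : R} (hxy : x * y = 0) (hyy : y * y = x ^ 3) (hx4 : x ^ 4 = 0)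
    {p q : R} (hp : ∃ a b, p = a * x ^ 2 + b * y) (hq : ∃ a b, q = a * x ^ 2 + b * y) :
    ∃ r, p * q = r * x ^ 3 := by
  obtain ⟨a, b, rfl⟩ := hp
  obtain ⟨c, d, rfl⟩ := hq
  exact ⟨b * d, by linear_combination a * c * hx4 + (a * d + b * c) * x * hxy + b * d * hyy⟩

/-- The entries of `adj S` lie in `x²R` when the entries of `S` lie in `(x, y)`. [folklore] -/
theorem adjugate_apply_mem_sq_of_rel {x y : R} (hxy : x * y = 0) (hyy : y * y = x ^ 3)
    (S : Matrix (Fin 3) (Fin 3) R) (hS : ∀ i j, ∃ a b, S i j = a * x + b * y) (i j : Fin 3) :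
    ∃ r, S.adjugate i j = r * x ^ 2 := by
  refine adjugate_fin_three_induction S (fun z => ∃ r, z = r * x ^ 2) ?_ i j
  intro i j k l i' j' k' l'
  obtain ⟨r₁, h₁⟩ := mul_mem_sq_of_rel hxy hyy (hS i j) (hS k l)
  obtain ⟨r₂, h₂⟩ := mul_mem_sq_of_rel hxy hyy (hS i' j') (hS k' l')
  exact ⟨r₁ - r₂, by rw [h₁, h₂]; ring⟩

/-- The entries of `adj S` lie in `x³R` when the entries of `S` lie in `x²R + yR`. [folklore] -/
theorem adjugate_apply_mem_cube_of_rel {x y : R} (hxy : x * y = 0) (hyy : y * y = x ^ 3)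
    (hx4 : x ^ 4 = 0) (S : Matrix (Fin 3) (Fin 3) R) (hS : ∀ i j, ∃ a b, S i j = a * x ^ 2 + b * y)
    (i j : Fin 3) : ∃ r, S.adjugate i j = r * x ^ 3 := by
  refine adjugate_fin_three_induction S (fun z => ∃ r, z = r * x ^ 3) ?_ i j
  intro i j k l i' j' k' l'
  obtain ⟨r₁, h₁⟩ := mul_mem_cube_of_rel hxy hyy hx4 (hS i j) (hS k l)
  obtain ⟨r₂, h₂⟩ := mul_mem_cube_of_rel hxy hyy hx4 (hS i' j') (hS k' l')
  exact ⟨r₁ - r₂, by rw [h₁, h₂]; ring⟩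

variable [Algebra ℂ R]

/-- In the presented ring (`R = ℂ + Rx + Ry`, `xy = 0`, `x⁴ = 0`): `x²R = ℂx² + ℂx³`. [folklore] -/
theorem mul_sq_eq_smul_add_smul {x y : R} (hxy : x * y = 0) (hx4 : x ^ 4 = 0)
    (hloc : ∀ r : R, ∃ (c : ℂ) (a b : R), r = algebraMap ℂ R c + a * x + b * y) (t : R) :
    ∃ c c' : ℂ, t * x ^ 2 = c • x ^ 2 + c' • x ^ 3 := by
  obtain ⟨c, a, b, rfl⟩ := hloc t
  obtain ⟨c', a', b', rfl⟩ := hloc a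
  refine ⟨c, c', ?_⟩
  rw [Algebra.smul_def, Algebra.smul_def]
  linear_combination (b' * x ^ 2 + b * x) * hxy + a' * hx4

/-- **`dim_ℂ Col(adj S) ≤ 5` for the type `(1,2,1,1)`.**  Let `R` be a commutative `ℂ`-algebra with
elements `x, y` such that `xy = 0`, `y² = x³`, `x⁴ = 0`, `x³ ≠ 0` and `R = ℂ + Rx + Ry` (so `R` is the
local algebra `ℂ[x,y]/(xy, y² - x³)` with basis `1, x, y, x², x³`, Hilbert function `(1,2,1,1)`).  For every
`3 × 3` matrix `S` with entries in the maximal ideal `(x, y)` and `det S = 0`, the column module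
`Col(adj S) = {adj S · w}` has `ℂ`-dimension `≤ 5 = dim R`. [folklore] -/
theorem finrank_range_adjugate_mulVecLin_le_five {x y : R} (hxy : x * y = 0) (hyy : y * y = x ^ 3)
    (hx4 : x ^ 4 = 0) (hx3 : x ^ 3 ≠ 0)
    (hloc : ∀ r : R, ∃ (c : ℂ) (a b : R), r = algebraMap ℂ R c + a * x + b * y)
    (S : Matrix (Fin 3) (Fin 3) R) (hS : ∀ i j, ∃ a b, S i j = a * x + b * y) (hdet : S.det = 0) :
    Module.finrank ℂ (LinearMap.range (S.adjugate.mulVecLin.restrictScalars ℂ)) ≤ 5 := by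
  classical
  -- the comparison space `(ℂx² + ℂx³)³`, of dimension `≤ 6`
  let T : ((Fin 3 → ℂ) × (Fin 3 → ℂ)) →ₗ[ℂ] (Fin 3 → R) :=
    { toFun := fun cd => fun i => cd.1 i • x ^ 2 + cd.2 i • x ^ 3
      map_add' := fun u v => by
        ext i
        simp only [Prod.fst_add, Prod.snd_add, Pi.add_apply, add_smul]
        abel
      map_smul' := fun k u => by
        ext i
        simp only [Prod.smul_fst, Prod.smul_snd, Pi.smul_apply, smul_eq_mul, RingHom.id_apply,
          smul_add, mul_smul] }
  have hT6 : Module.finrank ℂ (LinearMap.range T) ≤ 6 := by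
    refine (LinearMap.finrank_range_le T).trans ?_
    rw [Module.finrank_prod, Module.finrank_fin_fun]
  set N : Submodule ℂ (Fin 3 → R) := LinearMap.range (S.adjugate.mulVecLin.restrictScalars ℂ) with hN
  -- entries of `adj S · w` lie in `x²R`
  have hentry : ∀ (w : Fin 3 → R) (i : Fin 3), ∃ t : R, (S.adjugate *ᵥ w) i = t * x ^ 2 := by
    intro w i
    choose r hr using fun j => adjugate_apply_mem_sq_of_rel hxy hyy S hS i j
    refine ⟨∑ j, r j * w j, ?_⟩
    rw [Matrix.mulVec, dotProduct, Finset.sum_mul]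
    exact Finset.sum_congr rfl fun j _ => by rw [hr j]; ring
  have hle : N ≤ LinearMap.range T := by
    rintro v ⟨w, rfl⟩
    choose c c' hc using fun i =>
      mul_sq_eq_smul_add_smul hxy hx4 hloc (Classical.choose (hentry w i))
    refine ⟨(c, c'), ?_⟩
    ext i
    have hi := Classical.choose_spec (hentry w i)
    change c i • x ^ 2 + c' i • x ^ 3 = (S.adjugate.mulVecLin w) i
    rw [Matrix.mulVecLin_apply, hi, hc i]
  by_cases heq : N = LinearMap.range T
  · -- equality is impossible: it would force `x² = 0`
    exfalso
    have hmem : ∀ i : Fin 3, (Pi.single i (x ^ 2) : Fin 3 → R) ∈ N := by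
      intro i
      rw [heq]
      refine ⟨(Pi.single i 1, 0), ?_⟩
      ext j
      change (Pi.single i (1 : ℂ) : Fin 3 → ℂ) j • x ^ 2 + (0 : Fin 3 → ℂ) j • x ^ 3 = _
      by_cases hji : j = i
      · subst hji; simp
      · simp [hji]
    choose W hW using fun i => hmem i
    -- `adj S · W' = x² · 1` for the matrix `W'` with columns `W i`
    set W' : Matrix (Fin 3) (Fin 3) R := fun k i => W i k with hW'
    have hprod : S.adjugate * W' = x ^ 2 • (1 : Matrix (Fin 3) (Fin 3) R) := by
      ext j i
      have h := congr_fun (hW i) j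
      simp only [LinearMap.coe_restrictScalars, Matrix.mulVecLin_apply] at h
      rw [Matrix.mul_apply, Matrix.smul_apply, Matrix.one_apply, smul_eq_mul, mul_ite, mul_one,
        mul_zero]
      rw [Matrix.mulVec, dotProduct] at h
      rw [show (∑ k, S.adjugate j k * W' k i) = ∑ k, S.adjugate j k * W i k from rfl, h,
        Pi.single_apply]
    -- hence `x² S = 0`
    have hx2S : ∀ a b, x ^ 2 * S a b = 0 := by
      have h1 : S * (S.adjugate * W') = x ^ 2 • S := by rw [hprod, Matrix.mul_smul, Matrix.mul_one]
      have h2 : S * (S.adjugate * W') = 0 := by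
        rw [← Matrix.mul_assoc, Matrix.mul_adjugate, hdet, zero_smul, Matrix.zero_mul]
      intro a b
      have h := congr_fun (congr_fun (h1.symm.trans h2) a) b
      simpa [Matrix.smul_apply, smul_eq_mul] using h
    -- so every entry of `S` lies in `x²R + yR`
    have hS' : ∀ a b, ∃ p q : R, S a b = p * x ^ 2 + q * y := by
      intro a b
      obtain ⟨p, q, hpq⟩ := hS a b
      obtain ⟨c, a', b', hp⟩ := hloc p
      have hc : c = 0 := by
        by_contra hc
        apply hx3
        have h0 : algebraMap ℂ R c * x ^ 3 = 0 := by
          have := hx2S a b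
          rw [hpq, hp] at this
          linear_combination this - (b' * x ^ 2 + q * x) * hxy - a' * hx4
        have h0' : c • x ^ 3 = 0 := by rwa [Algebra.smul_def]
        have := congr_arg (fun z => c⁻¹ • z) h0'
        simpa [smul_smul, inv_mul_cancel₀ hc] using this
      refine ⟨a', q, ?_⟩
      rw [hpq, hp, hc, map_zero]
      linear_combination b' * hxy
    -- and every entry of `adj S` lies in `x³R`; read off the `(0,0)` entry of `adj S · W' = x²·1`
    choose t ht using fun k => adjugate_apply_mem_cube_of_rel hxy hyy hx4 S hS' 0 k
    have h00 := congr_fun (congr_fun hprod 0) 0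
    rw [Matrix.mul_apply, Matrix.smul_apply, Matrix.one_apply_eq, smul_eq_mul, mul_one] at h00
    have hx2 : x ^ 2 = (∑ k, t k * W' k 0) * x ^ 3 := by
      rw [← h00, Finset.sum_mul]
      exact Finset.sum_congr rfl fun k _ => by rw [ht k]; ring
    set u := ∑ k, t k * W' k 0 with hu
    apply hx3
    have hx2' : x ^ 2 = 0 := by
      linear_combination (1 + u * x + u ^ 2 * x ^ 2 + u ^ 3 * x ^ 3) * hx2 + u ^ 4 * x ^ 2 * hx4
    linear_combination x * hx2'
  · have hlt : N < LinearMap.range T := lt_of_le_of_ne hle heq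
    have := Submodule.finrank_lt_finrank_of_lt hlt
    omega

/-- **`AL(3)` for the type `(1,2,1,1)`**: `dim_ℂ Col(adj S) + dim_ℂ Row(adj S) ≤ 10` for every
`S ∈ Mat₃((x, y))` with `det S = 0` over the presented ring `ℂ[x,y]/(xy, y² - x³)`
(`Row(adj S) = Col((adj S)ᵀ) = Col(adj Sᵀ)`). [folklore] -/
theorem adjugateLength_three_le_ten {x y : R} (hxy : x * y = 0) (hyy : y * y = x ^ 3)
    (hx4 : x ^ 4 = 0) (hx3 : x ^ 3 ≠ 0)
    (hloc : ∀ r : R, ∃ (c : ℂ) (a b : R), r = algebraMap ℂ R c + a * x + b * y)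
    (S : Matrix (Fin 3) (Fin 3) R) (hS : ∀ i j, ∃ a b, S i j = a * x + b * y) (hdet : S.det = 0) :
    Module.finrank ℂ (LinearMap.range (S.adjugate.mulVecLin.restrictScalars ℂ)) +
        Module.finrank ℂ (LinearMap.range (S.adjugateᵀ.mulVecLin.restrictScalars ℂ)) ≤ 10 := by
  have h₁ := finrank_range_adjugate_mulVecLin_le_five hxy hyy hx4 hx3 hloc S hS hdet
  have h₂ := finrank_range_adjugate_mulVecLin_le_five hxy hyy hx4 hx3 hloc Sᵀ
    (fun i j => hS j i) (by rw [Matrix.det_transpose, hdet])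
  rw [← Matrix.adjugate_transpose] at h₂
  omega

/-- **`AL(3)` for the type `(1,2,1,1)`, in the form consumed by
`rank_hess0_transl_le_of_blockNormalForm_general_of_AL`**: if moreover `5 ≤ dim_ℂ R` (the presented
ring has dimension exactly `5`), then `dim Col(adj S) + dim Row(adj S) ≤ 2 · dim_ℂ R`. [folklore] -/
theorem adjugateLength_three_le {x y : R} (hxy : x * y = 0) (hyy : y * y = x ^ 3)
    (hx4 : x ^ 4 = 0) (hx3 : x ^ 3 ≠ 0)
    (hloc : ∀ r : R, ∃ (c : ℂ) (a b : R), r = algebraMap ℂ R c + a * x + b * y)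
    (hR : 5 ≤ Module.finrank ℂ R)
    (S : Matrix (Fin 3) (Fin 3) R) (hS : ∀ i j, ∃ a b, S i j = a * x + b * y) (hdet : S.det = 0) :
    Module.finrank ℂ (LinearMap.range (S.adjugate.mulVecLin.restrictScalars ℂ)) +
        Module.finrank ℂ (LinearMap.range (S.adjugateᵀ.mulVecLin.restrictScalars ℂ)) ≤
      2 * Module.finrank ℂ R :=
  (adjugateLength_three_le_ten hxy hyy hx4 hx3 hloc S hS hdet).trans (by omega)

/-- The same with the hypotheses phrased through a character `φ : R → ℂ` with `ker φ = (x, y)`: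
entries of `S` in `ker φ` and `R = ℂ + ker φ` automatically. [folklore] -/
theorem adjugateLength_three_le_of_ker (φ : R →ₐ[ℂ] ℂ) {x y : R} (hxy : x * y = 0)
    (hyy : y * y = x ^ 3) (hx4 : x ^ 4 = 0) (hx3 : x ^ 3 ≠ 0)
    (hker : ∀ r : R, φ r = 0 → ∃ a b : R, r = a * x + b * y) (hR : 5 ≤ Module.finrank ℂ R)
    (S : Matrix (Fin 3) (Fin 3) R) (hS : ∀ i j, φ (S i j) = 0) (hdet : S.det = 0) :
    Module.finrank ℂ (LinearMap.range (S.adjugate.mulVecLin.restrictScalars ℂ)) +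
        Module.finrank ℂ (LinearMap.range (S.adjugateᵀ.mulVecLin.restrictScalars ℂ)) ≤
      2 * Module.finrank ℂ R := by
  have hloc : ∀ r : R, ∃ (c : ℂ) (a b : R), r = algebraMap ℂ R c + a * x + b * y := by
    intro r
    have h0 : φ (r - algebraMap ℂ R (φ r)) = 0 := by
      rw [map_sub, AlgHom.commutes, Algebra.algebraMap_self, RingHom.id_apply, sub_self]
    obtain ⟨a, b, hab⟩ := hker _ h0
    exact ⟨φ r, a, b, by rw [add_assoc, ← hab]; ring⟩
  exact adjugateLength_three_le hxy hyy hx4 hx3 hloc hR S (fun i j => hker _ (hS i j)) hdet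

end OneTwoOneOne

end Summit.ValiantsHypothesis.ValiantsHypothesis.Theorems.GrenetZeonPolySizeQPAlgebra

end
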